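import Literature.NumberTheory.PAdicHodge.AinfRamifiedDivisionTransportTateModule
import Literature.NumberTheory.PAdicHodge.BmaxPlusFormalLogFrobeniusNondegenerate
import Literature.NumberTheory.PAdicHodge.BmaxPlusTatePeriodHom
import Literature.NumberTheory.PAdicHodge.BmaxPlusToBdRPeriods
import Literature.NumberTheory.PAdicHodge.BdRPlusFormalLogThetaKernel
import HarnessLib

/-!
# Non-degeneracy of the `φ`-partner for ALL nonzero Tate-module points, and for the TRANSPORTED towers of a ramified good model

Topic `Literature/NumberTheory/PAdicHodge` (theorems only; no definition, no named fact, no instance, no `sorry`). Sequel of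
`BmaxPlusFormalLogFrobeniusNondegenerate` (for `W/ℤ` with good supersingular reduction at `p ≥ 5`: `θ_max(φ Λ_1(ι[τ̃], z)) ≠ 0` for every
`τ ∈ T_pŴ(𝒪_{ℂ_F})` with `‖p‖ < ‖τ₁‖`) and of `AinfRamifiedDivisionTransportTateModule` (the CM-fibre transport `T` on `T_pŴ_D`).

* §0 (generic coefficients) `norm_evalAt_formalMul_prime_le_max` — **`‖[p]_W(t)‖ ≤ max(‖p‖‖t‖, ‖t‖ᵖ)`** over any coefficient ring acting on
  `𝒪_K` (AEC IV.4.4 `[p] = p·f + g(Xᵖ)`), `coe_eq_zero_of_divisionSeq_norm_le` — an exact tower with all levels of norm `≤ c < 1` vanishes;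
* §1 `val_pow_nsmul_pt_shift` (`p^s • u_{s+n} = u_n` along an exact tower), `val_pow_nsmul_eq_iterate_mulPC`, `torsionLiftHom_eq_divisionLiftPt`;
* §2 ★★ `AinfTop.thetaBmaxPlus_frobBmaxPlus_logSum_ne_zero_of_ne_zero` — **`θ_max(φ Λ_N(ι[τ̃], z)) ≠ 0` for EVERY `τ ≠ 0` in `T_pŴ(𝒪_{ℂ_F})`** and
  every index `N ≥ 1` (`W/ℤ` good supersingular, `p ≥ 5`): shift `τ` down to its first nonzero level `m` (`τ = p^{m−1}•τ″` with `τ″₁ ≠ 0`, so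
  `‖p‖ < ‖τ″₁‖` by `norm_p_lt_norm_pow_of_mulPC_eq_zero`), `Λ_N(ι[τ̃]) = p^{m−1}·p^{N−1}·Λ_1(ι[τ̃″])` (`logSum_nsmul_divisionLiftPt`,
  `logSum_eq_pow_mul_logSum`), and `θ_max(φΛ_1(ι[τ̃″])) ≠ 0`.
* §3 `exists_transport_ne_zero` (**`T` is injective**: rigidity of `[p]_{W_D}`-towers) and ★★ `thetaBmaxPlus_frobBmaxPlus_logSum_transport_ne_zero` —
  for the ramified model `W_D ≡ E₀ (mod ϖ)` (`E₀/ℤ` good supersingular, `p ≥ 5`), `τ ≠ 0` in `T_pŴ_D`, its transport `w = T(τ)` (`N ≥ e`) and any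
  witness: **if `θ_max(Λ_N(ι[w̃], z)) = 0` then `θ_max(φ Λ_N(ι[w̃], z)) ≠ 0`** (`θ(Λ) = 0` ⟹ `log_ω(P([p]^r w₀)) = 0` on the deep multiple `p^r • [w̃]`
  (`IsFormalLogModFil.thetaBdR_eq_padicLogPointFiniteExt_ptOfZ`) ⟹ `w₀` is `p`-power torsion (`padicLogPointFiniteExt_eq_zero_iff`,
  `exists_pow_nsmul_eq_zero_of_isOfFinAddOrder`) ⟹ `p^{j+r} • w` is a NONZERO torsion tower of `E₀`, to which §2 applies;
  `Λ_N(ι(p^k • [w̃])) = p^k·Λ_N(ι[w̃])`).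

Purpose (line `kato_lever`, crux K★ `stmt-BirchSwinnertonDyer-22226`, memo `Lines/kato-lever-K2-ramified-cm-transport.md` §8–§9): the socket's
`hnot` for the cells' Hodge pair `(Pω″, Pη″) = (A·P⁰ + B·Q⁰, B⁻¹·P⁰)` built from the transported maps `P⁰ = f∘LT`, `Q⁰ = f∘φ∘LT`
(`BmaxPlusTransportedPeriodHom`): with (HL-eval) on torsion towers (`A·θP⁰ + B·θQ⁰ = 0` on `T_pŴ_D`) and `B ≠ 0`, `θP⁰ ≡ 0` would force `θQ⁰ ≡ 0`,
contradicting §3 at any `τ ≠ 0`; so some `P⁰ τ ∉ Fil¹`. What is NOT here: `hne : Pω″ ≢ 0` (a comparison with K1's `∫ω_{W_D}`) and `B ≠ 0` (a cell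
computation). BSD / K★ are NOT proved by any of this; nothing about elliptic curves over number fields is proved here.

## References
* J. Tate, *p-divisible groups* (1967), §4. [Tate1967]
* J.-M. Fontaine, *Le corps des périodes p-adiques*, Astérisque 223 (1994), Exp. II §1.2–1.5, Exp. III Prop. 5.1.3. [FontaineAsterisque223III]
* P. Colmez, *Périodes p-adiques des variétés abéliennes*, Math. Ann. 292 (1992), §2. [Colmez1992PeriodesAbeliennes]
* J. H. Silverman, *The Arithmetic of Elliptic Curves* (2009), Prop. IV.3.2, Thm. IV.6.4, Prop. VII.2.2. [SilvermanAEC2009]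
* N. M. Katz, *Crystalline cohomology, Dieudonné modules, and Jacobi sums* (1981), Thm. 5.1.4–5.1.5. [Katz1981CrystallineDieudonne]
-/

noncomputable section

open Ideal WittVector ValuativeRel Field
open scoped Classical

namespace Literature.NumberTheory.PAdicHodge

open Literature.NumberTheory.GaloisRepresentations Literature.NumberTheory.GaloisRepresentations.IsNonarchimedeanLocalField
open Literature.NumberTheory.GaloisRepresentations.LubinTate Literature.NumberTheory.EllipticCurves
open Literature.NumberTheory.EllipticCurves.FormalGroupChart
open Literature.RingTheory.FormalGroups

/-! ## §0 Generic: `‖[p]_W t‖ ≤ max(‖p‖‖t‖, ‖t‖ᵖ)` over any coefficient ring, and rigidity of small towers -/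

section Generic

variable {A : Type*} [CommRing A] [UniformSpace A] [DiscreteUniformity A]
  {K : Type*} [NontriviallyNormedField K] [IsUltrametricDist K] [CompleteSpace K]
  [Algebra A (unitBall K)] [ContinuousSMul A (unitBall K)] {p : ℕ} [Fact p.Prime]

/-- ★ **`‖[p]_W(t)‖ ≤ max(‖p‖·‖t‖, ‖t‖ᵖ)`** for a Weierstrass equation over ANY coefficient ring `A` acting on `𝒪_K` (AEC IV.4.4 over every ring:
`[p] = p·f + g(Xᵖ)` with `f(0) = g(0) = 0`, tree `formalMul_prime_eq_add_expand`; the hypothesis `f(0) = 0` holds whenever `A` has no `p`-torsion,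
e.g. `constantCoeff_formalMulPPart` over `𝒪_D`). [cite: SilvermanAEC2009, IV.4.4] -/
theorem norm_evalAt_formalMul_prime_le_max (W : WeierstrassCurve A) (hf0 : PowerSeries.constantCoeff (W.formalMulPPart p) = 0)
    (t : (ballNilIdeal K).toIdeal) :
    ‖((evalAt (ballNilIdeal K) t (W.formalMul p) : unitBall K) : K)‖ ≤
      max (‖(p : K)‖ * ‖((t : unitBall K) : K)‖) (‖((t : unitBall K) : K)‖ ^ p) := by
  have hp : p.Prime := Fact.out
  obtain ⟨f', hf'⟩ := PowerSeries.X_dvd_iff.mpr hf0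
  obtain ⟨g', hg'⟩ := PowerSeries.X_dvd_iff.mpr (W.constantCoeff_formalMulFrobPart p)
  have hexp : PowerSeries.expand p hp.ne_zero (W.formalMulFrobPart p) = PowerSeries.X ^ p * PowerSeries.expand p hp.ne_zero g' := by
    rw [hg', map_mul, PowerSeries.expand_X]
  have heval : ((evalAt (ballNilIdeal K) t (W.formalMul p) : unitBall K) : K) =
      (p : K) * (((t : unitBall K) : K) * (evalAt (ballNilIdeal K) t f' : K)) +
        ((t : unitBall K) : K) ^ p * (evalAt (ballNilIdeal K) t (PowerSeries.expand p hp.ne_zero g') : K) := by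
    rw [W.formalMul_prime_eq_add_expand p, hexp, hf']
    simp only [map_add, map_mul, map_pow, map_natCast, Literature.NumberTheory.EllipticCurves.evalAt_X', Subring.coe_add,
      Subring.coe_mul, SubmonoidClass.coe_pow, Subring.coe_natCast]
  rw [heval]
  refine (IsUltrametricDist.norm_add_le_max _ _).trans (max_le_max ?_ ?_)
  · rw [norm_mul, norm_mul]
    exact mul_le_mul_of_nonneg_left (mul_le_of_le_one_right (norm_nonneg _) (norm_coe_unitBall_le_one _)) (norm_nonneg _)
  · rw [norm_mul, norm_pow]
    exact mul_le_of_le_one_right (by positivity) (norm_coe_unitBall_le_one _)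

/-- ★ **Rigidity of small towers**: an exact `[p]_W`-tower `t` of `Ŵ(𝔪_K)` (`[p]t_{n+1} = t_n`) with ALL levels of norm `≤ c < 1` is the zero
tower (`‖t_n‖ ≤ ρᵏ·c` for every `k`, `ρ = max(‖p‖, c^{p−1}) < 1`, by the contraction estimate). In particular a nonzero torsion tower has levels of
norm `→ 1`. [cite: SilvermanAEC2009, IV.4.4] [cite: Colmez1992PeriodesAbeliennes, §2] -/
theorem coe_eq_zero_of_divisionSeq_norm_le (W : WeierstrassCurve A) (hf0 : PowerSeries.constantCoeff (W.formalMulPPart p) = 0)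
    (hpK : ‖(p : K)‖ < 1) {c : ℝ} (hc : c < 1) (t : ℕ → (ballNilIdeal K).toIdeal)
    (ht : ∀ n, evalPt₁ (ballNilIdeal K) (W.formalMul p) (W.constantCoeff_formalMul p) (t (n + 1)) = t n)
    (hle : ∀ n, ‖(((t n : (ballNilIdeal K).toIdeal) : unitBall K) : K)‖ ≤ c) (n : ℕ) :
    (((t n : (ballNilIdeal K).toIdeal) : unitBall K) : K) = 0 := by
  have hp : p.Prime := Fact.out
  have hc0 : 0 ≤ c := (norm_nonneg _).trans (hle 0)
  set ρ := max ‖(p : K)‖ (c ^ (p - 1)) with hρ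
  have hρ0 : 0 ≤ ρ := le_max_of_le_left (norm_nonneg _)
  have hρ1 : ρ < 1 := max_norm_prime_pow_lt_one hpK hc0 hc
  have key : ∀ k m, ‖(((t m : (ballNilIdeal K).toIdeal) : unitBall K) : K)‖ ≤ ρ ^ k * c := by
    intro k
    induction k with
    | zero => intro m; rw [pow_zero, one_mul]; exact hle m
    | succ k ih =>
      intro m
      have hb0 : 0 ≤ ρ ^ k * c := mul_nonneg (pow_nonneg hρ0 k) hc0
      have hbc : ρ ^ k * c ≤ c := mul_le_of_le_one_left hc0 (pow_le_one₀ hρ0 hρ1.le)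
      have hx := ih (m + 1)
      rw [← ht m, coe_evalPt₁_eq_evalAt]
      refine (norm_evalAt_formalMul_prime_le_max W hf0 (t (m + 1))).trans (max_le ?_ ?_)
      · calc ‖(p : K)‖ * ‖(((t (m + 1) : (ballNilIdeal K).toIdeal) : unitBall K) : K)‖
            ≤ ρ * (ρ ^ k * c) := mul_le_mul (le_max_left _ _) hx (norm_nonneg _) hρ0
          _ = ρ ^ (k + 1) * c := by ring
      · have hp1 : p = (p - 1) + 1 := (Nat.sub_add_cancel hp.one_lt.le).symm
        calc ‖(((t (m + 1) : (ballNilIdeal K).toIdeal) : unitBall K) : K)‖ ^ p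
            ≤ (ρ ^ k * c) ^ p := pow_le_pow_left₀ (norm_nonneg _) hx p
          _ = (ρ ^ k * c) ^ (p - 1) * (ρ ^ k * c) := by rw [← pow_succ, ← hp1]
          _ ≤ c ^ (p - 1) * (ρ ^ k * c) := mul_le_mul_of_nonneg_right (pow_le_pow_left₀ hb0 hbc _) hb0
          _ ≤ ρ * (ρ ^ k * c) := mul_le_mul_of_nonneg_right (le_max_right _ _) hb0
          _ = ρ ^ (k + 1) * c := by ring
  have hlim : Filter.Tendsto (fun k : ℕ => ρ ^ k * c) Filter.atTop (nhds 0) := by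
    simpa using (tendsto_pow_atTop_nhds_zero_of_lt_one hρ0 hρ1).mul_const c
  have h0 : ‖(((t n : (ballNilIdeal K).toIdeal) : unitBall K) : K)‖ ≤ 0 :=
    ge_of_tendsto' hlim fun k => key k n
  exact norm_eq_zero.1 (le_antisymm h0 (norm_nonneg _))

end Generic

/-! ## §1–§2 `W/ℤ`: `θ(φ L_τ) ≠ 0` for every nonzero `τ ∈ T_pŴ` -/

namespace AinfTop

variable {F : Type} [Field F] [ValuativeRel F] [TopologicalSpace F] [IsNonarchimedeanLocalField F] [CharZero F]
  {p : ℕ} [Fact p.Prime] [Fact (¬ IsUnit (p : integerC F))] [IsAdicComplete (Ideal.span {(p : integerC F)}) (integerC F)]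
  {hθ : Function.Surjective (fontaineTheta (integerC F) p)} (W : WeierstrassCurve ℤ)

omit [CharZero F] [Fact p.Prime] [Fact (¬ IsUnit (p : integerC F))] [IsAdicComplete (Ideal.span {(p : integerC F)}) (integerC F)] in
/-- **`p^s • u_{s+n} = u_n`** in `Ŵ(𝔪_{ℂ_F})` along an exact `[p]_W`-tower `u`. [cite: SilvermanAEC2009, IV.2.3] -/
theorem val_pow_nsmul_pt_shift {u : ℕ → (maxNilIdealC F).toIdeal} (hup : ∀ n, mulPC F p W (u (n + 1)) = u n) (s n : ℕ) :
    (p ^ s • (⟨u (s + n)⟩ : W.Pt (maxNilIdealC F))).val = u n := by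
  induction s generalizing n with
  | zero => rw [pow_zero, one_smul, Nat.zero_add]
  | succ s ih =>
    have h1 : p • (⟨u (s + 1 + n)⟩ : W.Pt (maxNilIdealC F)) = ⟨u (s + n)⟩ :=
      WeierstrassCurve.Pt.ext (by rw [← GaloisContinuity.mulPC_eq_val_nsmul (p := p), show s + 1 + n = (s + n) + 1 by ring, hup])
    rw [pow_succ, mul_smul, h1, ih]

omit [CharZero F] [Fact p.Prime] [Fact (¬ IsUnit (p : integerC F))] [IsAdicComplete (Ideal.span {(p : integerC F)}) (integerC F)] in
/-- `(p^r • ⟨t⟩).val = [p]_W^{r} t`. [cite: SilvermanAEC2009, IV.2.3] -/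
theorem val_pow_nsmul_eq_iterate_mulPC (t : (maxNilIdealC F).toIdeal) (r : ℕ) :
    (p ^ r • (⟨t⟩ : W.Pt (maxNilIdealC F))).val = (mulPC F p W)^[r] t := by
  induction r with
  | zero => rw [pow_zero, one_smul, Function.iterate_zero, id]
  | succ r ih => rw [pow_succ', mul_smul, Function.iterate_succ_apply', ← ih, GaloisContinuity.mulPC_eq_val_nsmul (p := p)]

/-- `[τ̃]` (the homomorphism `torsionLiftHom`) is Fontaine's integral of the coordinate sequence `seq τ`. [cite: FontaineAsterisque223III, Exp. II §1.2.2] -/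
theorem torsionLiftHom_eq_divisionLiftPt (τ : TatePt F p W) :
    torsionLiftHom W hθ τ = divisionLiftPt W hθ (seq W τ) (mulPC_seq W τ) :=
  WeierstrassCurve.Pt.ext (Subtype.ext (by rw [coe_val_torsionLiftHom, coe_val_divisionLiftPt]))

set_option maxHeartbeats 3200000 in
/-- ★★ **`θ_max(φ Λ_N(ι[τ̃], z)) ≠ 0` for EVERY nonzero `τ ∈ T_pŴ(𝒪_{ℂ_F})`** (`W/ℤ` with good supersingular reduction at `p ≥ 5`, `W ⊗ ℚ_p` and
`W ⊗ 𝔽_p` elliptic, any index `N ≥ 1`, any witness). Let `m = s + 1 ≥ 1` be the first nonzero level of `τ` and `τ″ₙ := τ_{s+n}` the shifted tower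
(`τ″ ∈ T_pŴ`, `τ″₁ = τ_m ≠ 0` with `[p]τ″₁ = τ_s = 0`, so `‖p‖ < ‖τ″₁‖` at supersingular reduction, `norm_p_lt_norm_pow_of_mulPC_eq_zero`); then
`[τ̃] = p^s • [τ̃″]`, `Λ_N(ι[τ̃]) = p^s·Λ_N(ι[τ̃″]) = p^s·p^{N−1}·Λ_1(ι[τ̃″])` (`logSum_nsmul_divisionLiftPt`, `logSum_eq_pow_mul_logSum`) and
`θ_max(φΛ_1(ι[τ̃″])) ≠ 0` (`thetaBmaxPlus_frobBmaxPlus_logSum_ne_zero`). [cite: Tate1967, §4] [cite: FontaineAsterisque223III, Exp. III Prop. 5.1.3]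
[cite: Colmez1992PeriodesAbeliennes, §2] -/
theorem thetaBmaxPlus_frobBmaxPlus_logSum_ne_zero_of_ne_zero (hp5 : 5 ≤ p) (hΔ : ¬ (p : ℤ) ∣ W.Δ)
    (hA : (W.map (Int.castRingHom (ZMod p))).hasseCoeff p = 0) [(W.map (Int.castRingHom ℚ_[p])).IsElliptic]
    [(W.map (Int.castRingHom (ZMod p))).IsElliptic] (τ : TatePt F p W) (hτ : τ ≠ 0) {N : ℕ} (hN : 1 ≤ N) {z : bmaxZero F p}
    (hz : algebraMap (Ainf (p := p) F) (bmaxZero F p) ((of F p).symm (((torsionLiftHom W hθ τ).val : (nilTheta F p hθ).toIdeal) : AinfTop F p)) ^ N =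
      (p : bmaxZero F p) * z) :
    thetaBmaxPlus F p (frobBmaxPlus F p (PadicLogSeries.logSum ((algebraMap (Ainf (p := p) F) (bmaxZero F p)).comp zpToAinf) (GaloisContinuity.formalLogNum W p) N
          (algebraMap (Ainf (p := p) F) (bmaxZero F p) ((of F p).symm (((torsionLiftHom W hθ τ).val : (nilTheta F p hθ).toIdeal) : AinfTop F p))) z)) ≠ 0 := by
  have hp : p.Prime := Fact.out
  have hp2 : p ≠ 2 := by omega
  haveI := isDomain_bmaxZero (F := F) (p := p)
  haveI := charZero_bmaxZero (F := F) (p := p)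
  -- the first nonzero level `s + 1`
  have hex : ∃ n, ((seq W τ n : (maxNilIdealC F).toIdeal) : CBall F) ≠ 0 := by
    by_contra h
    push Not at h
    exact hτ (seq_injective W (funext fun n => Subtype.ext ((h n).trans (seq_zero_elem W n).symm)))
  obtain ⟨s, hs0, hs1⟩ : ∃ s, ((seq W τ s : (maxNilIdealC F).toIdeal) : CBall F) = 0 ∧
      ((seq W τ (s + 1) : (maxNilIdealC F).toIdeal) : CBall F) ≠ 0 := by
    have hm := Nat.find_spec hex
    have hm0 : Nat.find hex ≠ 0 := fun h0 => by rw [h0] at hm; exact hm (seq_zero W τ)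
    obtain ⟨s, hs⟩ := Nat.exists_eq_add_one_of_ne_zero hm0
    refine ⟨s, ?_, by rw [← hs]; exact hm⟩
    have h := Nat.find_min hex (show s < Nat.find hex by omega)
    push Not at h
    exact h
  -- the shifted tower `τ″ₙ = τ_{s+n}`
  have ht'' : ∀ n, mulPC F p W (seq W τ (s + (n + 1))) = seq W τ (s + n) := mulPC_shift W (mulPC_seq W τ) s
  have ht''0 : (((fun n => seq W τ (s + n)) 0 : (maxNilIdealC F).toIdeal) : CBall F) = 0 := by
    change ((seq W τ (s + 0) : (maxNilIdealC F).toIdeal) : CBall F) = 0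
    rw [Nat.add_zero]; exact hs0
  obtain ⟨τ'', hτ''⟩ : ∃ τ'' : TatePt F p W, seq W τ'' = fun n => seq W τ (s + n) := ⟨ofSeq W (fun n => seq W τ (s + n)) ht''0 ht'', rfl⟩
  -- `‖p‖ < ‖τ″₁‖`
  have h₁ : ‖(p : CompletedAlgClosure F)‖ < ‖(((seq W τ'' 1 : (maxNilIdealC F).toIdeal) : CBall F) : CompletedAlgClosure F)‖ := by
    have hne1 : (((seq W τ (s + 1) : (maxNilIdealC F).toIdeal) : CBall F) : CompletedAlgClosure F) ≠ 0 := fun h =>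
      hs1 (Subtype.ext h)
    have hmul : ((mulPC F p W (seq W τ (s + 1)) : (maxNilIdealC F).toIdeal) : CBall F) = 0 := by rw [mulPC_seq]; exact hs0
    have hlt := norm_p_lt_norm_pow_of_mulPC_eq_zero W hp2 hA (seq W τ (s + 1)) hne1 hmul
    have hle1 : ‖(((seq W τ (s + 1) : (maxNilIdealC F).toIdeal) : CBall F) : CompletedAlgClosure F)‖ ≤ 1 :=
      (mem_unitBall_iff _).mp (((seq W τ (s + 1) : (maxNilIdealC F).toIdeal) : CBall F)).2
    rw [hτ'']
    exact hlt.trans_le (pow_le_of_le_one (norm_nonneg _) hle1 hp.ne_zero)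
  -- `[τ̃] = p^s • [τ̃″]`
  have hseq : (fun n => (p ^ s • (⟨(fun n => seq W τ (s + n)) n⟩ : W.Pt (maxNilIdealC F))).val) = seq W τ :=
    funext fun n => val_pow_nsmul_pt_shift W (mulPC_seq W τ) s n
  have hpt2 : torsionLiftHom W hθ τ = p ^ s • divisionLiftPt W hθ (fun n => seq W τ (s + n)) ht'' := by
    rw [torsionLiftHom_eq_divisionLiftPt, ← GaloisContinuity.divisionLiftPt_val_nsmul_pt W (u := fun n => seq W τ (s + n)) ht'' (p ^ s)]
    exact divisionLiftPt_congr W hseq.symm _ _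
  have hpt'' : torsionLiftHom W hθ τ'' = divisionLiftPt W hθ (fun n => seq W τ (s + n)) ht'' := by
    rw [torsionLiftHom_eq_divisionLiftPt]; exact divisionLiftPt_congr W hτ'' _ _
  -- witnesses for `[τ̃″]` at indices `1` and `N`
  obtain ⟨z₁, hz₁⟩ := exists_witness_of_thetaPt_eq_zero W _ (thetaPt_torsionLiftHom W (hθ := hθ) τ'') le_rfl
  obtain ⟨zN, hzN⟩ := exists_witness_of_thetaPt_eq_zero W _ (thetaPt_torsionLiftHom W (hθ := hθ) τ'') hN
  -- Honda data and the non-degeneracy at `τ″`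
  obtain ⟨e, he⟩ := exists_natCast_mul_eq_honda_formalLogNum W (p := p)
  have hz₁' : algebraMap (Ainf (p := p) F) (bmaxZero F p) ((of F p).symm (((divisionLiftPt W hθ (seq W τ'') (mulPC_seq W τ'')).val : (nilTheta F p hθ).toIdeal) : AinfTop F p)) ^ 1 =
      (p : bmaxZero F p) * z₁ := by
    rw [← torsionLiftHom_eq_divisionLiftPt]; exact hz₁
  have hne'' := thetaBmaxPlus_frobBmaxPlus_logSum_ne_zero W (hθ := hθ) hp5 hΔ hA _ e he τ'' h₁ hz₁'
  rw [← torsionLiftHom_eq_divisionLiftPt] at hne''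
  -- `Λ_N(ι[τ̃], z) = p^s · Λ_N(ι[τ̃″], zN) = p^s · p^{N-1} · Λ_1(ι[τ̃″], z₁)`
  have hdepth : ‖((((fun n => seq W τ (s + n)) 0 : (maxNilIdealC F).toIdeal) : CBall F) : CompletedAlgClosure F)‖ ^ N ≤
      ‖(p : CompletedAlgClosure F)‖ := by
    have h0 : ((((fun n => seq W τ (s + n)) 0 : (maxNilIdealC F).toIdeal) : CBall F) : CompletedAlgClosure F) = 0 := by
      rw [ht''0]; rfl
    rw [h0, norm_zero, zero_pow (by omega)]; exact norm_nonneg _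
  have hzk : algebraMap (Ainf (p := p) F) (bmaxZero F p) ((of F p).symm (((p ^ s • divisionLiftPt W hθ (fun n => seq W τ (s + n)) ht'').val : (nilTheta F p hθ).toIdeal) : AinfTop F p)) ^ N =
      (p : bmaxZero F p) * z := by
    rw [← hpt2]; exact hz
  have hzN' : algebraMap (Ainf (p := p) F) (bmaxZero F p) ((of F p).symm (((divisionLiftPt W hθ (fun n => seq W τ (s + n)) ht'').val : (nilTheta F p hθ).toIdeal) : AinfTop F p)) ^ N =
      (p : bmaxZero F p) * zN := by
    rw [← hpt'']; exact hzN
  have hscale := logSum_nsmul_divisionLiftPt W (hθ := hθ) (u := fun n => seq W τ (s + n)) ht'' hN hdepth (p ^ s) hzk hzN'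
  have hidx := PadicLogSeries.logSum_eq_pow_mul_logSum ((algebraMap (Ainf (p := p) F) (bmaxZero F p)).comp zpToAinf)
    (GaloisContinuity.formalLogNum W p) le_rfl hN hz₁ hzN
  have hofpow : AdicCompletion.of (Ideal.span {(p : bmaxZero F p)}) (bmaxZero F p) ((p : bmaxZero F p) ^ (N - 1)) =
      (p : BmaxPlus F p) ^ (N - 1) := by
    change algebraMap (bmaxZero F p) (BmaxPlus F p) ((p : bmaxZero F p) ^ (N - 1)) = _
    rw [map_pow, map_natCast]
  rw [hpt2, hscale, ← hpt'', hidx, hofpow, Nat.cast_pow]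
  simp only [map_mul, map_pow, map_natCast]
  exact mul_ne_zero (pow_ne_zero _ (natCast_integerC_ne_zero hp.ne_zero))
    (mul_ne_zero (pow_ne_zero _ (natCast_integerC_ne_zero hp.ne_zero)) hne'')

end AinfTop

/-! ## §3 The transported towers of `T_pŴ_D` -/

section Transported

variable {F : Type} [Field F] [ValuativeRel F] [TopologicalSpace F] [IsNonarchimedeanLocalField F] [CharZero F]
  {p : ℕ} [hpp : Fact p.Prime] [Fact (¬ IsUnit (p : integerC F))] [IsAdicComplete (Ideal.span {(p : integerC F)}) (integerC F)]
  {hp : valuation F p < 1} (D : EisensteinRoot F p hp) {hθ : Function.Surjective (fontaineTheta (integerC F) p)}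
  (W : WeierstrassCurve (EisensteinRoot.CoeffDisc D)) (E₀ : WeierstrassCurve ℤ)
  (hWE : W.map (Ideal.Quotient.mk (Ideal.span {EisensteinRoot.CoeffDisc.of D (AdjoinRoot.root D.poly)})) =
    (E₀.map (algebraMap ℤ (EisensteinRoot.CoeffDisc D))).map
      (Ideal.Quotient.mk (Ideal.span {EisensteinRoot.CoeffDisc.of D (AdjoinRoot.root D.poly)})))
  (ψ : EisensteinRoot.CoeffDisc D →+* LTCoeff F) (hψ : ∀ c, algebraMap (LTCoeff F) F (ψ c) = EisensteinRoot.CoeffDisc.toF D c)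

include hψ in
omit [IsAdicComplete (Ideal.span {(p : integerC F)}) (integerC F)] in
/-- **`T` is injective: the transport of a nonzero `τ ∈ T_pŴ_D` is not the zero tower.** If `T(τ) = 0` then every level of the exact `[p]_{W_D}`-tower
`seqO τ` has norm `≤ ‖ϖ‖ < 1`, so `seqO τ = 0` by the rigidity of small towers (`coe_eq_zero_of_divisionSeq_norm_le`, over the coefficient ring `𝒪_D`).
[cite: Colmez1992PeriodesAbeliennes, §2] [cite: SilvermanAEC2009, IV.4.4] -/
theorem exists_transport_ne_zero (τ : AinfTop.TatePtO F (W.map ψ) p) (hτ : τ ≠ 0) {w : ℕ → (maxNilIdealC F).toIdeal}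
    (hwv : ∀ n, ‖(((w n : (maxNilIdealC F).toIdeal) : CBall F) : CompletedAlgClosure F) -
      (((AinfTop.seqO (W.map ψ) τ n : (maxNilIdealC F).toIdeal) : CBall F) : CompletedAlgClosure F)‖ ≤ ‖((D.rootC : integerC F) : CompletedAlgClosure F)‖) :
    ∃ n, (((w n : (maxNilIdealC F).toIdeal) : CBall F) : CompletedAlgClosure F) ≠ 0 := by
  by_contra h
  push Not at h
  apply hτ
  apply AinfTop.seqO_injective (W.map ψ)
  funext n
  have hsmall : ∀ m, ‖(((AinfTop.seqO (W.map ψ) τ m : (maxNilIdealC F).toIdeal) : CBall F) : CompletedAlgClosure F)‖ ≤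
      ‖((D.rootC : integerC F) : CompletedAlgClosure F)‖ := fun m => by
    have h1 := hwv m
    rwa [h m, zero_sub, norm_neg] at h1
  have hz := coe_eq_zero_of_divisionSeq_norm_le (K := CompletedAlgClosure F) W (constantCoeff_formalMulPPart W) norm_natCast_C_lt_one'
    D.norm_rootC_lt_one (AinfTop.seqO (W.map ψ) τ) (AinfRamTop.mulPC_seqO W ψ hψ τ) hsmall n
  have h0 : AinfTop.seqO (W.map ψ) (0 : AinfTop.TatePtO F (W.map ψ) p) n = 0 := by
    rw [AinfTop.seqO_apply, map_zero, WeierstrassCurve.Pt.val_zero]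
  rw [h0]
  exact Subtype.ext (Subtype.ext hz)

include hψ in
set_option maxHeartbeats 3200000 in
/-- ★★ **Non-degeneracy of the transported `φ`-partner.** Let `W_D ≡ E₀ (mod ϖ)` with `E₀/ℤ` of good supersingular reduction at `p ≥ 5`
(`p ∤ Δ(E₀)`, Hasse coefficient `0`; `E₀ ⊗ ℚ_p`, `E₀ ⊗ 𝔽_p`, `E₀ ⊗ ℂ_F` elliptic), `τ ≠ 0` in `T_pŴ_D`, `w = T(τ)` its transport, `N ≥ e`, `z` a witness.
**If `θ_max(Λ_N(ι[w̃], z)) = 0` then `θ_max(φ Λ_N(ι[w̃], z)) ≠ 0`.** Proof: `w ≠ 0` (`T` injective); on the deep multiple `p^r • [w̃]` the vanishing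
`θ(Λ) = 0` reads `log_ω(P([p]^r w₀)) = 0` (`IsFormalLogModFil.thetaBdR_eq_padicLogPointFiniteExt_ptOfZ`), so `w₀` is `p`-power torsion in `Ê₀(𝔪_ℂ)`
(`padicLogPointFiniteExt_eq_zero_iff`, `exists_pow_nsmul_eq_zero_of_isOfFinAddOrder`); then `p^{j+r} • w` is a NONZERO torsion tower of `E₀` with
`Λ_N(ι(p^{j+r} • [w̃])) = p^{j+r}·Λ_N(ι[w̃])` (`logSum_nsmul_divisionLiftPt`), and §2 applies to it. [cite: Tate1967, §4]
[cite: FontaineAsterisque223III, Exp. III Prop. 5.1.3] [cite: Katz1981CrystallineDieudonne, Thm. 5.1.5] [cite: SilvermanAEC2009, Thm. IV.6.4 with Prop. VII.2.2] -/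
theorem thetaBmaxPlus_frobBmaxPlus_logSum_transport_ne_zero (hpv : valuation F p < 1) (hp5 : 5 ≤ p) (hΔ : ¬ (p : ℤ) ∣ E₀.Δ)
    (hA : (E₀.map (Int.castRingHom (ZMod p))).hasseCoeff p = 0) [(E₀.map (Int.castRingHom ℚ_[p])).IsElliptic]
    [(E₀.map (Int.castRingHom (ZMod p))).IsElliptic] [(curveOver (CompletedAlgClosure F) E₀).IsElliptic]
    (τ : AinfTop.TatePtO F (W.map ψ) p) (hτ : τ ≠ 0) {w : ℕ → (maxNilIdealC F).toIdeal}
    (hw : ∀ n, AinfTop.mulPC F p E₀ (w (n + 1)) = w n)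
    (hwv : ∀ n, ‖(((w n : (maxNilIdealC F).toIdeal) : CBall F) : CompletedAlgClosure F) -
      (((AinfTop.seqO (W.map ψ) τ n : (maxNilIdealC F).toIdeal) : CBall F) : CompletedAlgClosure F)‖ ≤ ‖((D.rootC : integerC F) : CompletedAlgClosure F)‖)
    {N : ℕ} (hN : D.e ≤ N) {z : bmaxZero F p} (hz : algebraMap (Ainf (p := p) F) (bmaxZero F p)
        ((AinfTop.of F p).symm (((AinfTop.divisionLiftPt E₀ hθ w hw).val : (AinfTop.nilTheta F p hθ).toIdeal) : AinfTop F p)) ^ N = (p : bmaxZero F p) * z)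
    (h0 : thetaBmaxPlus F p (PadicLogSeries.logSum ((algebraMap (Ainf (p := p) F) (bmaxZero F p)).comp zpToAinf) (GaloisContinuity.formalLogNum E₀ p) N
          (algebraMap (Ainf (p := p) F) (bmaxZero F p)
            ((AinfTop.of F p).symm (((AinfTop.divisionLiftPt E₀ hθ w hw).val : (AinfTop.nilTheta F p hθ).toIdeal) : AinfTop F p))) z) = 0) :
    thetaBmaxPlus F p (frobBmaxPlus F p (PadicLogSeries.logSum ((algebraMap (Ainf (p := p) F) (bmaxZero F p)).comp zpToAinf) (GaloisContinuity.formalLogNum E₀ p) N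
          (algebraMap (Ainf (p := p) F) (bmaxZero F p)
            ((AinfTop.of F p).symm (((AinfTop.divisionLiftPt E₀ hθ w hw).val : (AinfTop.nilTheta F p hθ).toIdeal) : AinfTop F p))) z)) ≠ 0 := by
  have hprime : p.Prime := Fact.out
  haveI : CharZero (CompletedAlgClosure F) := charZero_of_injective_algebraMap (algebraMap F _).injective
  haveI := isDomain_bmaxZero (F := F) (p := p)
  haveI := charZero_bmaxZero (F := F) (p := p)
  have hN1 : 1 ≤ N := D.e_pos.trans_le hN
  have hp0C : (p : CompletedAlgClosure F) ≠ 0 := Nat.cast_ne_zero.2 hprime.ne_zero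
  have hpC : ‖(p : CompletedAlgClosure F)‖ < 1 := norm_natCast_C_lt_one hpv
  have hpCv : NormedField.valuation (p : CompletedAlgClosure F) < 1 := by
    rw [← NNReal.coe_lt_coe, NormedField.valuation_apply, coe_nnnorm]; exact hpC
  have hwN := norm_transport_seqO_zero_pow_le D W ψ τ hwv hN
  -- a deep multiple `v = p^r • w`, `[ṽ] = p^r • [w̃]`
  obtain ⟨r, hr⟩ := GaloisContinuity.exists_norm_iterate_mulPC_le (F := F) (p := p) E₀ (w 0)
  have hv := GaloisContinuity.mulPC_val_nsmul_pt E₀ (p := p) (u := w) hw (p ^ r)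
  have hv0 : ‖((((fun i => (p ^ r • (⟨w i⟩ : E₀.Pt (maxNilIdealC F))).val) 0 : (maxNilIdealC F).toIdeal) : CBall F) :
      CompletedAlgClosure F)‖ ≤ ‖(p : CompletedAlgClosure F)‖ := by
    change ‖((((p ^ r • (⟨w 0⟩ : E₀.Pt (maxNilIdealC F))).val : (maxNilIdealC F).toIdeal) : CBall F) : CompletedAlgClosure F)‖ ≤ _
    rw [AinfTop.val_pow_nsmul_eq_iterate_mulPC]; exact hr
  have hptr : AinfTop.divisionLiftPt E₀ hθ (fun i => (p ^ r • (⟨w i⟩ : E₀.Pt (maxNilIdealC F))).val) hv =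
      p ^ r • AinfTop.divisionLiftPt E₀ hθ w hw := GaloisContinuity.divisionLiftPt_val_nsmul_pt E₀ (u := w) hw (p ^ r)
  obtain ⟨zr, hzr⟩ := exists_algebraMap_pow_eq_natCast_mul (AinfTop.pow_coe_val_nsmul_divisionLiftPt_mem E₀ (hθ := hθ) (u := w) hw hwN (p ^ r))
  have hscale := AinfTop.logSum_nsmul_divisionLiftPt E₀ (hθ := hθ) (u := w) hw hN1 hwN (p ^ r) hzr hz
  have h0r : thetaBmaxPlus F p (PadicLogSeries.logSum ((algebraMap (Ainf (p := p) F) (bmaxZero F p)).comp zpToAinf) (GaloisContinuity.formalLogNum E₀ p) N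
          (algebraMap (Ainf (p := p) F) (bmaxZero F p)
            ((AinfTop.of F p).symm (((p ^ r • AinfTop.divisionLiftPt E₀ hθ w hw).val : (AinfTop.nilTheta F p hθ).toIdeal) : AinfTop F p))) zr) = 0 := by
    rw [hscale, map_mul, h0, mul_zero]
  -- the value `L'` of `log_{E₀}` at `[ṽ]` and `θ(L') = log_ω(P(v₀)) = 0`
  obtain ⟨L', hL'eq, hL'⟩ := exists_forall_isFormalLogModFil_bmaxPlusToBdR_logSum E₀ hN1
    ((AinfTop.of F p).symm (((p ^ r • AinfTop.divisionLiftPt E₀ hθ w hw).val : (AinfTop.nilTheta F p hθ).toIdeal) : AinfTop F p)) hzr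
  have hx : (AinfTop.of F p).symm (AinfTop.torsionLift E₀ hθ (fun i => (p ^ r • (⟨w i⟩ : E₀.Pt (maxNilIdealC F))).val) hv) =
      (AinfTop.of F p).symm (((p ^ r • AinfTop.divisionLiftPt E₀ hθ w hw).val : (AinfTop.nilTheta F p hθ).toIdeal) : AinfTop F p) := by
    rw [← AinfTop.coe_val_divisionLiftPt, hptr]
  have hL'v : GaloisContinuity.IsFormalLogModFil E₀ 1
      ((AinfTop.of F p).symm (AinfTop.torsionLift E₀ hθ (fun i => (p ^ r • (⟨w i⟩ : E₀.Pt (maxNilIdealC F))).val) hv)) L' := by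
    rw [hx]; exact hL' 1
  have hθL' := GaloisContinuity.IsFormalLogModFil.thetaBdR_eq_padicLogPointFiniteExt_ptOfZ (hθ := hθ) hpv E₀ le_rfl
    (u := fun i => (p ^ r • (⟨w i⟩ : E₀.Pt (maxNilIdealC F))).val) hv hv0 hL'v
  have hθ0 : thetaBdR L' = 0 := by
    have h1 : thetaBdR ((p : BDeRhamPlus (integerC F) p) ^ N * L') = 0 := by
      rw [hL'eq, thetaBdR_bmaxPlusToBdR, h0r, ZeroMemClass.coe_zero]
    rw [map_mul, map_pow, map_natCast] at h1
    exact (mul_eq_zero.1 h1).resolve_left (pow_ne_zero _ hp0C)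
  rw [hθ0] at hθL'
  -- `w₀` is `p`-power torsion: `p^{j+r} • ⟨w₀⟩ = 0`
  have hker : ptOfZ (CompletedAlgClosure F) E₀ (((p ^ r • (⟨w 0⟩ : E₀.Pt (maxNilIdealC F))).val : (maxNilIdealC F).toIdeal)) ∈
      kernel (NormedField.valuation (K := CompletedAlgClosure F)) (curveOver (CompletedAlgClosure F) E₀) := ptOfZ_mem_kernel _
  obtain ⟨r', hr'⟩ := exists_pow_smul_mem_level_of_mem_kernel hp0C hker
  have hfin := (padicLogPointFiniteExt_eq_zero_iff_of_completeSpace hp0C hpCv (pow_pos hprime.pos r') hr').1 hθL'.symm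
  obtain ⟨j, hj⟩ := GaloisContinuity.exists_pow_nsmul_eq_zero_of_isOfFinAddOrder E₀ hpC hker hfin
  have hvj := GaloisContinuity.nsmul_pt_eq_zero_of_nsmul_ptOfZ_eq_zero (F := F) E₀ _ (p ^ j) hj
  have hw0 : p ^ (j + r) • (⟨w 0⟩ : E₀.Pt (maxNilIdealC F)) = 0 := by
    rw [pow_add, mul_smul]
    have e : (⟨((fun i => (p ^ r • (⟨w i⟩ : E₀.Pt (maxNilIdealC F))).val) 0)⟩ : E₀.Pt (maxNilIdealC F)) =
        p ^ r • (⟨w 0⟩ : E₀.Pt (maxNilIdealC F)) := WeierstrassCurve.Pt.ext rfl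
    rw [← e]; exact hvj
  -- the NONZERO torsion tower `τ' := p^{j+r} • w ∈ T_pÊ₀`
  have hv' := GaloisContinuity.mulPC_val_nsmul_pt E₀ (p := p) (u := w) hw (p ^ (j + r))
  have hv'0 : ((((fun i => (p ^ (j + r) • (⟨w i⟩ : E₀.Pt (maxNilIdealC F))).val) 0 : (maxNilIdealC F).toIdeal) : CBall F)) = 0 := by
    change (((p ^ (j + r) • (⟨w 0⟩ : E₀.Pt (maxNilIdealC F))).val : (maxNilIdealC F).toIdeal) : CBall F) = 0
    rw [hw0, WeierstrassCurve.Pt.val_zero]; rfl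
  obtain ⟨τ', hτ'⟩ : ∃ τ' : AinfTop.TatePt F p E₀, AinfTop.seq E₀ τ' = fun i => (p ^ (j + r) • (⟨w i⟩ : E₀.Pt (maxNilIdealC F))).val :=
    ⟨AinfTop.ofSeq E₀ (fun i => (p ^ (j + r) • (⟨w i⟩ : E₀.Pt (maxNilIdealC F))).val) hv'0 hv', rfl⟩
  have hτ'0 : τ' ≠ 0 := by
    obtain ⟨n, hn⟩ := exists_transport_ne_zero D W ψ hψ τ hτ hwv
    intro h
    apply hn
    have h1 : ((AinfTop.seq E₀ τ' (j + r + n) : (maxNilIdealC F).toIdeal) : CBall F) = 0 := by rw [h]; exact AinfTop.seq_zero_elem E₀ _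
    have h2 : AinfTop.seq E₀ τ' (j + r + n) = w n := by
      rw [hτ']; exact AinfTop.val_pow_nsmul_pt_shift E₀ (u := w) hw (j + r) n
    rw [h2] at h1
    rw [h1]; rfl
  have hpt' : AinfTop.torsionLiftHom E₀ hθ τ' = p ^ (j + r) • AinfTop.divisionLiftPt E₀ hθ w hw := by
    rw [AinfTop.torsionLiftHom_eq_divisionLiftPt, AinfTop.divisionLiftPt_congr E₀ hτ' (AinfTop.mulPC_seq E₀ τ') hv']
    exact GaloisContinuity.divisionLiftPt_val_nsmul_pt E₀ (u := w) hw (p ^ (j + r))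
  obtain ⟨z', hz'⟩ := exists_algebraMap_pow_eq_natCast_mul (AinfTop.pow_coe_val_nsmul_divisionLiftPt_mem E₀ (hθ := hθ) (u := w) hw hwN (p ^ (j + r)))
  have hscale' := AinfTop.logSum_nsmul_divisionLiftPt E₀ (hθ := hθ) (u := w) hw hN1 hwN (p ^ (j + r)) hz' hz
  have hz'τ : algebraMap (Ainf (p := p) F) (bmaxZero F p)
        ((AinfTop.of F p).symm (((AinfTop.torsionLiftHom E₀ hθ τ').val : (AinfTop.nilTheta F p hθ).toIdeal) : AinfTop F p)) ^ N = (p : bmaxZero F p) * z' := by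
    rw [hpt']; exact hz'
  have hne := AinfTop.thetaBmaxPlus_frobBmaxPlus_logSum_ne_zero_of_ne_zero E₀ (hθ := hθ) hp5 hΔ hA τ' hτ'0 hN1 hz'τ
  rw [hpt'] at hne
  rw [hscale', map_mul, map_natCast, map_mul, map_natCast] at hne
  exact fun h => hne (by rw [h, mul_zero])

end Transported

end Literature.NumberTheory.PAdicHodge
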